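import Summits.PneNP.PneNP.Theorems.QuotientSABlockCount
import Summits.PneNP.PneNP.Theorems.PstarExpandingExist

/-!
# ROUND-22 COR-B, target B3 (`BlockExpandExist`), part III: the term estimate and the existence of expanding block systems

FRONTIER range-avoidance ladder, rung F-N3 context (restricted-model combinatorics; nothing here bears on `P` vs `NP`).

The analytic layer of the first-moment argument over p3's random block model (`QuotientSABlockModel`) and the union bound of
part II (`QuotientSABlockCount`) — prover-1's `IP3ExpandingExist` at a GENERAL arity `K`:

* `key_identity` (exponent bookkeeping with `2^K` in place of `64`), `term_le`: for `f ≥ 1`, `K ≥ 3`, `L ≥ 6^{K+1}·κ·K`,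
  `K·L⁴·f ≤ N`, `nb ≤ κ·N`:  `C(nb,f)·C(N, vK K f)·(2^K (vK K f)^K / N^K)^f ≤ 2^{−f}`;
* `pow_le_card_emb` (`N^K ≤ 2^K·#(Slot s ↪ Fin N)` for `N ≥ 2K`), `card_badSet_lt`, `exists_good`;
* **`blockExpandExist : QuotientSABlocks.BlockExpandExist`** — with `s = 2C+3`, `n' = nb`, `K = (s+1)s`, `L = 6^{K+1}K`,
  `c = (s+2)·K·L⁴`: clean block systems whose block map is `(n/c, (2K−5)/2)`-boundary expanding exist at every stretch `C`
  (the existence input of HEADLINE-22 `SAAfterQuotientBlind`, via `QuotientSABlocks.saAfterQuotientBlind_of`).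
-/

set_option linter.dupNamespace false

open Finset Literature.Computability.Complexity
open Summit.PneNP.PneNP.Theorems.PstarSASDPLevel (BoundaryExpandingQ)
open Summit.PneNP.PneNP.Theorems.QuotientSABlocks
open Summit.PneNP.PneNP.Theorems.QuotientSABlockModel
open Summit.PneNP.PneNP.Theorems.QuotientSABlockCount
open Summit.PneNP.PneNP.Theorems.PstarExpandingExist (choose_le geom_half_lt_one)

namespace Summit.PneNP.PneNP.Theorems.QuotientSABlockExist

/-! ## The term estimate -/

/-- The exponent bookkeeping: with `a + b + q = K·a`,
`(3κN/f)^a · (3N/v)^b · (2^K v^K/N^K)^a = (3·2^K·κ·v/f)^a · 3^b · (v/N)^q`. -/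
theorem key_identity (K : ℕ) (κ N v f : ℝ) (hf : f ≠ 0) (hv : v ≠ 0) (hN : N ≠ 0) (a b q : ℕ) (h : a + b + q = K * a) :
    (3 * κ * N / f) ^ a * (3 * N / v) ^ b * (2 ^ K * v ^ K / N ^ K) ^ a =
      (3 * 2 ^ K * κ * v / f) ^ a * 3 ^ b * (v / N) ^ q := by
  have e1 : ((2 : ℝ) ^ K * v ^ K / N ^ K) ^ a = (2 ^ K) ^ a * v ^ (a + b + q) / N ^ (a + b + q) := by
    rw [h, div_pow, mul_pow, pow_mul, pow_mul]
  rw [e1]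
  simp only [pow_add, div_pow, mul_pow]
  field_simp

/-- **The term estimate.**  For `1 ≤ f`, `3 ≤ K`, `6^{K+1}·κ·K ≤ L`, `K·L⁴·f ≤ N`, `nb ≤ κ·N`:
`C(nb,f)·C(N, vK K f)·(2^K (vK K f)^K / N^K)^f ≤ 2^{−f}`. -/
theorem term_le (K κ L N f nb : ℕ) (hf : 1 ≤ f) (hK : 3 ≤ K) (hL : 6 ^ (K + 1) * κ * K ≤ L) (hL1 : 1 ≤ L)
    (hN : K * L ^ 4 * f ≤ N) (hnb : nb ≤ κ * N) :
    (nb.choose f : ℝ) * (N.choose (vK K f) : ℝ) * (2 ^ K * ((vK K f : ℕ) : ℝ) ^ K / (N : ℝ) ^ K) ^ f ≤ (1 / 2) ^ f := by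
  set v := vK K f with hvdef
  set q := (f + 3) / 4 with hqdef
  have hvq : v + f + q = K * f := by
    have := vK_add (show 2 ≤ K by omega) f
    omega
  have hq1 : 1 ≤ q := by omega
  have hqf : f ≤ 4 * q := by omega
  have hvK : v ≤ K * f := vK_le K f
  have hv1 : 1 ≤ v := by
    have : 3 * f ≤ K * f := Nat.mul_le_mul_right f hK
    omega
  have hL4 : 1 ≤ L ^ 4 := Nat.one_le_pow _ _ hL1
  have hK1 : 1 ≤ K := by omega
  have hN1 : 1 ≤ N := le_trans (by nlinarith) hN
  have hfR : (0 : ℝ) < f := by exact_mod_cast hf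
  have hvR : (0 : ℝ) < v := by exact_mod_cast hv1
  have hNR : (0 : ℝ) < N := by exact_mod_cast hN1
  have hLR : (1 : ℝ) ≤ L := by exact_mod_cast hL1
  have hκR : (0 : ℝ) ≤ κ := by positivity
  have hKR : (0 : ℝ) ≤ K := by positivity
  have hA : (nb.choose f : ℝ) ≤ (3 * κ * N / f) ^ f := by
    refine (choose_le nb f hf).trans (pow_le_pow_left₀ (by positivity) ?_ _)
    have : (nb : ℝ) ≤ κ * N := by exact_mod_cast hnb
    rw [div_le_div_iff_of_pos_right hfR]
    linarith
  have hB : (N.choose v : ℝ) ≤ (3 * N / v) ^ v := choose_le N v hv1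
  have hE : (nb.choose f : ℝ) * (N.choose v : ℝ) * (2 ^ K * (v : ℝ) ^ K / (N : ℝ) ^ K) ^ f ≤
      (3 * κ * N / f) ^ f * (3 * N / v) ^ v * (2 ^ K * (v : ℝ) ^ K / (N : ℝ) ^ K) ^ f := by
    have h0 : (0 : ℝ) ≤ (2 ^ K * (v : ℝ) ^ K / (N : ℝ) ^ K) ^ f := by positivity
    exact mul_le_mul_of_nonneg_right (mul_le_mul hA hB (by positivity) (by positivity)) h0
  rw [key_identity K κ N v f hfR.ne' hvR.ne' hNR.ne' f v q (by rw [← hvq]; ring)] at hE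
  refine hE.trans ?_
  have f1 : (3 * 2 ^ K * κ * v / f : ℝ) ^ f ≤ (3 * 2 ^ K * κ * K) ^ f := by
    refine pow_le_pow_left₀ (by positivity) ?_ _
    rw [div_le_iff₀ hfR]
    have : (v : ℝ) ≤ K * f := by exact_mod_cast hvK
    have h2 : (0 : ℝ) ≤ 3 * 2 ^ K * κ := by positivity
    nlinarith
  have f2 : (3 : ℝ) ^ v ≤ (3 ^ K) ^ f := by
    calc (3 : ℝ) ^ v ≤ 3 ^ (K * f) := pow_le_pow_right₀ (by norm_num) hvK
      _ = (3 ^ K) ^ f := by rw [pow_mul]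
  have f3 : ((v : ℝ) / N) ^ q ≤ (1 / L) ^ f := by
    have h1 : (v : ℝ) / N ≤ 1 / L ^ 4 := by
      rw [div_le_div_iff₀ hNR (by positivity)]
      have : (K * L ^ 4 * f : ℝ) ≤ N := by exact_mod_cast hN
      have : (v : ℝ) ≤ K * f := by exact_mod_cast hvK
      nlinarith
    calc ((v : ℝ) / N) ^ q ≤ (1 / L ^ 4) ^ q := pow_le_pow_left₀ (by positivity) h1 _
      _ = (1 / L) ^ (4 * q) := by rw [div_pow, div_pow, one_pow, one_pow, ← pow_mul]
      _ ≤ (1 / L) ^ f := pow_le_pow_of_le_one (by positivity) (by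
          rw [div_le_one (by positivity)]; exact hLR) hqf
  have hprod : (3 * 2 ^ K * κ * v / f : ℝ) ^ f * 3 ^ v * ((v : ℝ) / N) ^ q ≤
      (3 * 2 ^ K * κ * K) ^ f * (3 ^ K) ^ f * (1 / L) ^ f :=
    mul_le_mul (mul_le_mul f1 f2 (by positivity) (by positivity)) f3 (by positivity) (by positivity)
  refine hprod.trans ?_
  rw [← mul_pow, ← mul_pow]
  refine pow_le_pow_left₀ (by positivity) ?_ _
  have hL' : (6 ^ (K + 1) * κ * K : ℝ) ≤ L := by exact_mod_cast hL
  have hL0 : (0 : ℝ) < L := by linarith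
  have e6 : (3 * 2 ^ K * κ * K * 3 ^ K : ℝ) = 6 ^ (K + 1) * κ * K / 2 := by
    rw [pow_succ, show (6 : ℝ) = 2 * 3 by norm_num, mul_pow]
    ring
  rw [e6, show (6 ^ (K + 1) * κ * K / 2 * (1 / L) : ℝ) = 6 ^ (K + 1) * κ * K / L / 2 by ring]
  rw [div_le_div_iff_of_pos_right (by norm_num : (0:ℝ) < 2), div_le_one hL0]
  exact hL'

/-! ## Counting embeddings -/

/-- `N^K ≤ 2^K·#(Slot s ↪ Fin N)` for `N ≥ 2K` (`K = kBlk s`). -/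
theorem pow_le_card_emb (s N : ℕ) (hN : 2 * kBlk s ≤ N) :
    (N : ℝ) ^ kBlk s ≤ 2 ^ kBlk s * (Fintype.card (Slot s ↪ Fin N) : ℝ) := by
  set K := kBlk s with hK
  rw [Fintype.card_embedding_eq, Fintype.card_fin]
  change (N : ℝ) ^ K ≤ 2 ^ K * (N.descFactorial K : ℝ)
  have h1 : (N + 1 - K) ^ K ≤ N.descFactorial K := Nat.pow_sub_le_descFactorial N K
  have h2 : ((N + 1 - K : ℕ) : ℝ) = (N : ℝ) + 1 - K := by
    rw [Nat.cast_sub (by omega)]; push_cast; ring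
  have h3 : ((N : ℝ) + 1 - K) ^ K ≤ (N.descFactorial K : ℝ) := by
    rw [← h2]; exact_mod_cast h1
  have hN' : (2 * K : ℝ) ≤ N := by exact_mod_cast hN
  have h4 : (N : ℝ) / 2 ≤ (N : ℝ) + 1 - K := by linarith
  have h5 : ((N : ℝ) / 2) ^ K ≤ ((N : ℝ) + 1 - K) ^ K := pow_le_pow_left₀ (by positivity) h4 K
  have h6 : ((N : ℝ) / 2) ^ K = (N : ℝ) ^ K / 2 ^ K := by rw [div_pow]
  rw [h6] at h5
  have := h5.trans h3
  rw [div_le_iff₀ (by positivity)] at this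
  linarith

/-! ## Good outcomes exist -/

/-- **The summed union bound is below the number of outcomes** (pure arithmetic in an abstract arity `K` and an abstract count
`Q ≥ N^K/2^K` of slot maps): with `L ≥ 6^{K+1}κK`, `K·L⁴·r ≤ N`, `nb ≤ κN`,
`Σ_{i<r} C(nb,i+1)·C(N,vK K (i+1))·((vK K (i+1))^K)^{i+1}·Q^{nb−(i+1)} < Q^{nb}`. -/
theorem sum_terms_lt (K κ L N nb r : ℕ) (Q : ℝ) (hK : 3 ≤ K) (hL : 6 ^ (K + 1) * κ * K ≤ L) (hL1 : 1 ≤ L)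
    (hQK : (N : ℝ) ^ K ≤ 2 ^ K * Q) (hQpos : 0 < Q) (hr : K * L ^ 4 * r ≤ N) (hnb : nb ≤ κ * N) :
    ∑ i ∈ Finset.range r, (nb.choose (i + 1) : ℝ) * (N.choose (vK K (i + 1)) : ℝ) *
        (((vK K (i + 1) : ℕ) : ℝ) ^ K) ^ (i + 1) * Q ^ (nb - (i + 1)) < Q ^ nb := by
  have hterm : ∀ i ∈ Finset.range r,
      (nb.choose (i + 1) : ℝ) * (N.choose (vK K (i + 1)) : ℝ) * ((((vK K (i + 1) : ℕ) : ℝ) ^ K) ^ (i + 1)) *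
          Q ^ (nb - (i + 1)) ≤ (1 / 2) ^ (i + 1) * Q ^ nb := by
    intro i hi
    rw [Finset.mem_range] at hi
    have hs : K * L ^ 4 * (i + 1) ≤ N := (Nat.mul_le_mul_left _ (by omega : i + 1 ≤ r)).trans hr
    have hsm : i + 1 ≤ nb ∨ nb < i + 1 := le_or_gt _ _
    have ht := term_le K κ L N (i + 1) nb (by omega) hK hL hL1 hs hnb
    rcases hsm with hsm | hsm
    · have hQsplit : Q ^ nb = Q ^ (i + 1) * Q ^ (nb - (i + 1)) := by
        rw [← pow_add]; congr 1; omega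
      rw [hQsplit]
      have hstep : ((((vK K (i + 1) : ℕ) : ℝ) ^ K) ^ (i + 1)) ≤
          (2 ^ K * ((vK K (i + 1) : ℕ) : ℝ) ^ K / (N : ℝ) ^ K) ^ (i + 1) * Q ^ (i + 1) := by
        rw [← mul_pow]
        refine pow_le_pow_left₀ (by positivity) ?_ _
        have hNK : (0 : ℝ) < (N : ℝ) ^ K := by
          have hN1 : (1 : ℝ) ≤ N := by
            have h1 : 1 * 1 * 1 ≤ K * L ^ 4 * (i + 1) :=
              Nat.mul_le_mul (Nat.mul_le_mul (by omega) (Nat.one_le_pow 4 L hL1)) (by omega)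
            have : 1 ≤ N := le_trans (by simpa using h1) hs
            exact_mod_cast this
          exact pow_pos (by linarith) K
        rw [div_mul_eq_mul_div, le_div_iff₀ hNK]
        have h0 : (0 : ℝ) ≤ ((vK K (i + 1) : ℕ) : ℝ) ^ K := by positivity
        nlinarith
      have hQm : (0 : ℝ) ≤ Q ^ (nb - (i + 1)) := by positivity
      have hcc : (0 : ℝ) ≤ (nb.choose (i + 1) : ℝ) * (N.choose (vK K (i + 1)) : ℝ) := by positivity
      calc (nb.choose (i + 1) : ℝ) * (N.choose (vK K (i + 1)) : ℝ) * (((vK K (i + 1) : ℕ) : ℝ) ^ K) ^ (i + 1) *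
            Q ^ (nb - (i + 1))
          ≤ (nb.choose (i + 1) : ℝ) * (N.choose (vK K (i + 1)) : ℝ) *
            ((2 ^ K * ((vK K (i + 1) : ℕ) : ℝ) ^ K / (N : ℝ) ^ K) ^ (i + 1) * Q ^ (i + 1)) * Q ^ (nb - (i + 1)) :=
            mul_le_mul_of_nonneg_right (mul_le_mul_of_nonneg_left hstep hcc) hQm
        _ = ((nb.choose (i + 1) : ℝ) * (N.choose (vK K (i + 1)) : ℝ) *
            (2 ^ K * ((vK K (i + 1) : ℕ) : ℝ) ^ K / (N : ℝ) ^ K) ^ (i + 1)) * (Q ^ (i + 1) * Q ^ (nb - (i + 1))) := by ring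
        _ ≤ (1 / 2) ^ (i + 1) * (Q ^ (i + 1) * Q ^ (nb - (i + 1))) := mul_le_mul_of_nonneg_right ht (by positivity)
    · rw [Nat.choose_eq_zero_of_lt hsm]
      simp only [Nat.cast_zero, zero_mul]
      positivity
  refine (Finset.sum_le_sum hterm).trans_lt ?_
  rw [← Finset.sum_mul]
  have hQm : (0 : ℝ) < Q ^ nb := by positivity
  calc (∑ i ∈ Finset.range r, (1 / 2 : ℝ) ^ (i + 1)) * Q ^ nb < 1 * Q ^ nb :=
        mul_lt_mul_of_pos_right (geom_half_lt_one r) hQm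
    _ = Q ^ nb := one_mul _

/-- **Good outcomes exist**: with `K = kBlk s ≥ 3`, `L ≥ 6^{K+1}κK`, `N ≥ 2K`, `nb ≤ κN`, `r = N/(K·L⁴)`, fewer outcomes are
bad than there are outcomes. -/
theorem card_badSet_lt (s κ L N nb : ℕ) (hK : 3 ≤ kBlk s) (hL : 6 ^ (kBlk s + 1) * κ * kBlk s ≤ L) (hL1 : 1 ≤ L)
    (hN : 2 * kBlk s ≤ N) (hnb : nb ≤ κ * N) :
    ((badSet s nb N (N / (kBlk s * L ^ 4))).card : ℝ) < (Fintype.card (Outcome s nb N) : ℝ) := by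
  have hL4 : 1 ≤ L ^ 4 := Nat.one_le_pow _ _ hL1
  have hr : kBlk s * L ^ 4 * (N / (kBlk s * L ^ 4)) ≤ N := by
    rw [Nat.mul_comm]; exact Nat.div_mul_le_self N _
  have hKr : kBlk s * (N / (kBlk s * L ^ 4)) ≤ N := by
    refine le_trans ?_ hr
    calc kBlk s * (N / (kBlk s * L ^ 4)) = kBlk s * 1 * (N / (kBlk s * L ^ 4)) := by ring
      _ ≤ kBlk s * L ^ 4 * (N / (kBlk s * L ^ 4)) := Nat.mul_le_mul_right _ (Nat.mul_le_mul_left _ hL4)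
  have hub := card_badSet_le (s := s) (nb := nb) (n' := N) _ hKr
  have hQK := pow_le_card_emb s N hN
  have hNpos : (0 : ℝ) < N := by exact_mod_cast (show 0 < N by omega)
  have hQpos : (0 : ℝ) < (Fintype.card (Slot s ↪ Fin N) : ℝ) := by
    have h1 : (0 : ℝ) < (N : ℝ) ^ kBlk s / 2 ^ kBlk s := by positivity
    refine lt_of_lt_of_le h1 ?_
    rw [div_le_iff₀ (by positivity)]
    linarith
  have hcardΩ : (Fintype.card (Outcome s nb N) : ℝ) = (Fintype.card (Slot s ↪ Fin N) : ℝ) ^ nb := by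
    rw [Fintype.card_fun, Fintype.card_fin]
    push_cast
    rfl
  rw [hcardΩ]
  exact lt_of_le_of_lt hub (sum_terms_lt (kBlk s) κ L N nb _ _ hK hL hL1 hQK hQpos hr hnb)

/-- **A good outcome exists.** -/
theorem exists_good (s κ L N nb : ℕ) (hK : 3 ≤ kBlk s) (hL : 6 ^ (kBlk s + 1) * κ * kBlk s ≤ L) (hL1 : 1 ≤ L)
    (hN : 2 * kBlk s ≤ N) (hnb : nb ≤ κ * N) : ∃ ω : Outcome s nb N, ¬bad (N / (kBlk s * L ^ 4)) ω := by
  classical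
  by_contra h
  push Not at h
  have hall : badSet s nb N (N / (kBlk s * L ^ 4)) = univ :=
    Finset.eq_univ_of_forall fun ω => by
      unfold badSet
      exact Finset.mem_filter.2 ⟨Finset.mem_univ _, h ω⟩
  have := card_badSet_lt s κ L N nb hK hL hL1 hN hnb
  rw [hall, Finset.card_univ] at this
  exact lt_irrefl _ this

/-! ## The existence of expanding clean block systems -/

/-- **T22.2-B — `QuotientSABlocks.BlockExpandExist` holds**: for every stretch `C`, with `s = 2C+3`, `K = (s+1)s`,
`L = 6^{K+1}K` and `c = (s+2)·K·L⁴`, for every `N` there is a clean block system on `nb = max N 2K` blocks with `n' = nb`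
A-variables satisfying all size conditions of the headline and whose block map is `(n/c, (2K−5)/2)`-boundary expanding for
every target (first-moment counting over outcomes `Fin nb → (Slot s ↪ Fin n')`).  Restricted-model combinatorics (cell
pnp-ideate, ROUND-22 COR-B); it says nothing about `P` versus `NP`. -/
theorem blockExpandExist : BlockExpandExist := by
  intro C
  set s := 2 * C + 3 with hs
  set K := kBlk s with hK
  have hK3 : 3 ≤ K := (stretch_arith C 1 le_rfl).2.2.2.2
  set L := 6 ^ (K + 1) * 1 * K with hL
  have hL1 : 1 ≤ L := by
    rw [hL]
    have : 1 ≤ 6 ^ (K + 1) := Nat.one_le_pow _ _ (by norm_num)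
    nlinarith
  refine ⟨s, (s + 2) * (K * L ^ 4), by positivity, hK3, fun N₀ => ?_⟩
  set nb := max N₀ (2 * K) with hnb
  have hnbN : N₀ ≤ nb := le_max_left _ _
  have hnb2 : 2 * K ≤ nb := le_max_right _ _
  have hnb1 : 1 ≤ nb := by omega
  obtain ⟨ω, hω⟩ := exists_good s 1 L nb nb hK3 (by rw [hL]) hL1 hnb2 (by omega)
  obtain ⟨h1, h2, h3, h4, -⟩ := stretch_arith C nb hnb1
  have hd : 0 < nb := hnb1
  refine ⟨nb, nb, sysOf ⟨0, hd⟩ ω, le_trans hnbN h4, h4, h1, h2, h3, fun b => ?_⟩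
  have hrad : nVars s nb nb / ((s + 2) * (K * L ^ 4)) = nb / (K * L ^ 4) := by
    have e : nVars s nb nb = (s + 2) * nb := by unfold nVars; ring
    rw [e, Nat.mul_div_mul_left _ _ (by omega : 0 < s + 2)]
  rw [hrad]
  exact blockSys_of_good ⟨0, hd⟩ ω _ (good_of_not_bad hω ⟨0, hd⟩) b

end Summit.PneNP.PneNP.Theorems.QuotientSABlockExist
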